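import Literature.MathematicalPhysics.QuantumLattice.InfVolFermionState
import HarnessLib

/-!
# Ergodic states carry no off-diagonal long-range order beyond the square of the order parameter

Topic `Literature/MathematicalPhysics/QuantumLattice`; fact request `wi-37917` ("ODLRO of a
translation-invariant state ⇔ decomposition into ergodic gauge-breaking components", Sewell 1970 /
Fannes–Pule–Verbeure 1982) for route `HubbardSuperconductivity/InfiniteVolumeFirst`, crux
`NoNormalLimitState`, on the carrier `InfVolFermionState` (states of the CAR algebra over `ℤ^d × {↑,↓}`
as compatible families of local states; `IsErgodic` = extremal translation-invariant;
`pairCorr ω S g x y = ω(P_x⋆ P_y)` the pair two-point function of the local singlet pairs `P_x`).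

What is printed, and what of it is stated here.

* Bratteli–Robinson I, Thm. 4.3.17: for a `G`-invariant state `ω` with `(𝔄, ω)` `G`-abelian,
  `ω` is `G`-ergodic iff the projection `E_ω` onto the `U_ω(G)`-invariant vectors of the GNS space has
  rank one (`= |Ω_ω⟩⟨Ω_ω|`); Prop. 4.3.4 (Alaoglu–Birkhoff mean ergodic theorem): averages of
  `U_ω(g)` over a Følner net converge strongly to `E_ω`. For the fermion lattice algebra and
  `G = ℤ^ν` the pair `(𝔄, ω)` is `ℤ^ν`-abelian for EVERY translation-invariant `ω`, which is moreover
  automatically even (Bratteli–Robinson II, Example 5.2.21; quoted in Araki–Moriya 2003, §11 before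
  Prop. 11.8: "it is well known that the pair `(𝔄, ω)` is `ℤ^ν`-abelian and that `ω` is automatically
  even"). Consequently, for a translation-ERGODIC state and any local observable `P` with translates
  `P_y = τ_y(P)`, `‖N^{-ν} Σ_{y ∈ [0,N)^ν} π_ω(P_y) Ω_ω‖² → ‖E_ω π_ω(P) Ω_ω‖² = |ω(P)|²`, i.e.
  `N^{-2ν} Σ_{x, y ∈ [0,N)^ν} ω(P_x⋆ P_y) → |ω(P_0)|²`.
* This is the mechanism behind Sewell 1970, §4 (off-diagonal long-range order of a state of the
  quasi-local algebra lives on its non-ergodic / gauge-breaking structure) and Fannes–Pule–Verbeure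
  1982 (= Verbeure, *Many-Body Boson Systems*, Thm. 4.2: condensation in a limit Gibbs state forces a
  decomposition into ergodic gauge-breaking states).

Stated here (NAMED FACT, `d = 2`, the case carried by `pairCorr`):
`ergodic_pairCorr_boxAverage` — for `ω` ergodic, `N⁻⁴ Σ_{x,y ∈ [0,N)²} ω(P_x⋆ P_y) → |ω(P_0)|²`.
PROVED from it: `not_isErgodic_of_odlro` — a translation-invariant state with `ω(P_0) = 0` (e.g. a
gauge-invariant one) whose box averages stay `≥ c > 0` (ODLRO, a Bochner atom at `0`) is NOT ergodic.
NOT stated (no topology / barycentric decomposition on `InfVolFermionState` yet): the ergodic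
decomposition `ω = ∫ ω_λ dλ` into gauge-breaking components with `ω_λ(P_0) ≠ 0` (the "⇒ components"
half of Sewell / Fannes–Pule–Verbeure) — recorded as a framework gap by the librarian.

## References

* O. Bratteli, D. W. Robinson, *Operator Algebras and Quantum Statistical Mechanics 1*, 2nd ed.,
  Springer (1987), Prop. 4.3.4, Thm. 4.3.17, Thm. 4.3.22, Example 4.3.26. [BratteliRobinsonI1987]
* O. Bratteli, D. W. Robinson, *Operator Algebras and Quantum Statistical Mechanics 2*, 2nd ed.,
  Springer (1997), Example 5.2.21. [BratteliRobinsonII1997]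
* H. Araki, H. Moriya, Rev. Math. Phys. 15 (2003) 93, §11 (remark before Prop. 11.8). [ArakiMoriya2003]
* G. L. Sewell, J. Math. Phys. 11 (1970) 1868, §4. [Sewell1970]
* M. Fannes, J. V. Pulè, A. Verbeure, Helv. Phys. Acta 55 (1982) 391. [FannesPuleVerbeure1982]
-/

noncomputable section

namespace Literature.MathematicalPhysics.QuantumLattice

open Finset Filter Topology Literature.Probability.LatticeModels

namespace InfVolFermionState

/-- **Ergodic states have no ODLRO beyond `|ω(P_0)|²`** (Bratteli–Robinson I Thm. 4.3.17 with the
mean ergodic theorem Prop. 4.3.4, for the `ℤ²`-abelian pair (CAR algebra, translation-invariant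
state) of Bratteli–Robinson II Ex. 5.2.21): for a translation-ergodic state `ω` of the lattice fermions
on `ℤ²` and the local singlet pairs `P_x` (step set `S`, form factor `g`),
`N⁻⁴ Σ_{x, y ∈ [0,N)²} ω(P_x⋆ P_y) ⟶ |ω(P_0)|²` as `N → ∞` — the Bochner atom at `0` of the pair
two-point function of an ERGODIC state is the squared modulus of its order parameter.
[cite: BratteliRobinsonI1987, Thm. 4.3.17 and Prop. 4.3.4 (with OAQSM 2, Example 5.2.21)] -/
def ergodic_pairCorr_boxAverage : Prop :=
  ∀ (ω : InfVolFermionState 2), ω.IsErgodic → ∀ (S : Finset (Site 2)) (g : Site 2 → ℝ),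
    Tendsto (fun N : ℕ => ((N : ℂ) ^ 4)⁻¹ *
        ∑ x ∈ halfOpenBox 2 N, ∑ y ∈ halfOpenBox 2 N, ω.pairCorr S g x y) atTop
      (𝓝 (((‖ω.expect (pairRegion S 0) (localPairAt S g 0)‖ ^ 2 : ℝ) : ℂ)))

/-- **ODLRO forces non-ergodicity** (the contrapositive use of `ergodic_pairCorr_boxAverage`, as in
Sewell 1970 §4 / Fannes–Pule–Verbeure 1982): if the order parameter vanishes, `ω(P_0) = 0` (e.g. `ω`
gauge invariant), but the box averages of the pair two-point function have real part `≥ c > 0` for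
all large `N` (off-diagonal long-range order), then `ω` is not translation-ergodic — so its ergodic
components, once a decomposition theory is available, must break the gauge symmetry.
[cite: BratteliRobinsonI1987, Thm. 4.3.17 (contrapositive)] -/
theorem not_isErgodic_of_odlro (h : ergodic_pairCorr_boxAverage) {ω : InfVolFermionState 2}
    {S : Finset (Site 2)} {g : Site 2 → ℝ} (h0 : ω.expect (pairRegion S 0) (localPairAt S g 0) = 0)
    {c : ℝ} (hc : 0 < c)
    (hodlro : ∀ᶠ N : ℕ in atTop, c ≤ (((N : ℂ) ^ 4)⁻¹ *
        ∑ x ∈ halfOpenBox 2 N, ∑ y ∈ halfOpenBox 2 N, ω.pairCorr S g x y).re) :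
    ¬ ω.IsErgodic := by
  intro herg
  have hlim := h ω herg S g
  rw [h0, norm_zero] at hlim
  simp only [ne_eq, OfNat.ofNat_ne_zero, not_false_eq_true, zero_pow, Complex.ofReal_zero] at hlim
  have hre : Tendsto (fun N : ℕ => (((N : ℂ) ^ 4)⁻¹ *
      ∑ x ∈ halfOpenBox 2 N, ∑ y ∈ halfOpenBox 2 N, ω.pairCorr S g x y).re) atTop (𝓝 0) := by
    have := (Complex.continuous_re.tendsto 0).comp hlim
    rwa [Complex.zero_re] at this
  have hev := hre.eventually (gt_mem_nhds hc)
  obtain ⟨N, hN1, hN2⟩ := (hodlro.and hev).exists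
  exact absurd hN1 (not_le.2 hN2)

end InfVolFermionState

end Literature.MathematicalPhysics.QuantumLattice
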